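import Literature.NumberTheory.LFunctions.KloostermanFractionsMainRegime
import Literature.NumberTheory.Sieve.DivisorBound
import HarnessLib

/-!
# Bilinear forms with Kloosterman fractions: Theorem 2 of Duke–Friedlander–Iwaniec

We assemble the proof of

  `‖Σ_{(m,n)=1} α_m β_n e(k m̄/n)‖ ≤ K_ε ‖α‖ ‖β‖ (|k| + MN)^{3/8} (M+N)^{11/48+ε}`

(Duke–Friedlander–Iwaniec, Invent. Math. 128 (1997), Theorem 2), following Bettin–Chandee
(arXiv:1502.00769) §§2–6 with amplifier `A = 1`: the per-`b` bound of
`KloostermanFractionsMainRegime` with `L = ⌈ℓ₁⌉ + ⌈ℓ₂⌉`, the square-free reduction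
(`kfC1_le_sum_Cb`, `sqf_sum_norm_sq`, `sqf_sum_rsqrt_le`), `𝓑 ≤ ‖α‖𝓒₁^{1/2}`, the trivial bound
outside the window `N^{5/6} ≤ M ≤ N^{6/5}` (and for `|k| > (MN)^{4/3}` or bounded `M + N`), and
the reduction to `β` supported on integers coprime to `k` (`DFI_bilinear_bound_of_coprime_case`).

Main results: `kff_core` (coprime support), `kff_h0` (Theorem 2 in the form needed by
`DukeFriedlanderIwaniec1997_bilinearKloostermanFractions_of_untwisted`; the discharge of the
named fact is in `DeterminantEquationDFIProofs.lean`).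

## References
* W. Duke, J. Friedlander, H. Iwaniec, *Bilinear forms with Kloosterman fractions*,
  Invent. Math. 128 (1997) 23–43, Theorem 2. [cite: DukeFriedlanderIwaniec1997, Theorem 2]
* S. Bettin, V. Chandee, Adv. Math. 328 (2018), arXiv:1502.00769, §§5–6.
  [cite: BettinChandee2018, §6]
-/

noncomputable section

open Finset

namespace Literature.NumberTheory.LFunctions

/-! ### One square-full `b` in the main regime -/

set_option maxHeartbeats 3000000 in
/-- **The contribution of one `b ≤ N^{1/2}` in the main regime**: with `L = ⌈ℓ₁⌉ + ⌈ℓ₂⌉`,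
`ℓ₁ = (b³M⁴/N³)^{1/8}`, `ℓ₂ = (b⁵M⁸/N⁷)^{1/10}`, on the window `N⁵ ≤ M⁶`, `M⁵ ≤ N⁶`,
`b^{1/2} 𝓒_b(⌊M⌋,⌊2M⌋; N/b, γ_b) ≤ 230000 S⁶ F₀^{1/2} (MN)^{3/4}(M+N)^{11/24} ‖γ_b‖²`
provided `ℓ₁ ≥ L₀ + 2 + 4(log b + log|k| + log⌊2M⌋)`, `T'` is a divisor bound on
`[1, 5000(M+N)⁴]`, and `S ≥ max(1, T', 6 + 3 log(M+N))`. [cite: BettinChandee2018, §5] -/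
theorem kff_main_b (k : ℤ) (hk : k ≠ 0) {b : ℕ} (hb : 0 < b) (β : ℕ → ℂ) {M N : ℝ}
    (hM : 1 ≤ M) (hN : 1 ≤ N) (hbN : (b : ℝ) ^ 2 ≤ N) (hw1 : N ^ 5 ≤ M ^ 6) (hw2 : M ^ 5 ≤ N ^ 6)
    (hβ : ∀ n, β n ≠ 0 → N < n ∧ (n : ℝ) ≤ 2 * N ∧ n.Coprime k.natAbs)
    {L₀ : ℕ} (hL₀ : ∀ L : ℕ, L₀ ≤ L →
      (L : ℝ) / (2 * Real.log L) ≤ (((Finset.Ioc L (2 * L)).filter Nat.Prime).card : ℝ))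
    (hbig : (L₀ : ℝ) + 2 + 4 * (Real.log b + Real.log k.natAbs + Real.log ⌊2 * M⌋₊) ≤
      ((b : ℝ) ^ 3 * M ^ 4 / N ^ 3) ^ (1 / 8 : ℝ))
    {T' S : ℝ} (hT' : ∀ w : ℕ, 1 ≤ w → (w : ℝ) ≤ 5000 * (M + N) ^ 4 → (w.divisors.card : ℝ) ≤ T')
    (hS1 : 1 ≤ S) (hST : T' ≤ S) (hSlog : 6 + 3 * Real.log (M + N) ≤ S) :
    Real.sqrt b * ∑ m ∈ (Ioc ⌊M⌋₊ ⌊2 * M⌋₊).filter (fun m => m.Coprime b),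
      ‖kfInner k b (N / b)
        (fun n' => if (Squarefree n' ∧ n'.Coprime b) then β (b * n') else 0) m‖ ^ 2 ≤
      (∑ n' ∈ Icc 1 ⌊2 * (N / b)⌋₊,
        ‖(if (Squarefree n' ∧ n'.Coprime b) then β (b * n') else 0)‖ ^ 2) *
      (230000 * S ^ 6 * Real.sqrt (1 + 64 * Real.pi * |(k : ℝ)| / (M * N)) *
        ((M * N) ^ (3 / 4 : ℝ) * (M + N) ^ (11 / 24 : ℝ))) := by
  set ℓ₁ : ℝ := ((b : ℝ) ^ 3 * M ^ 4 / N ^ 3) ^ (1 / 8 : ℝ) with hℓ₁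
  set ℓ₂ : ℝ := ((b : ℝ) ^ 5 * M ^ 8 / N ^ 7) ^ (1 / 10 : ℝ) with hℓ₂
  set L : ℕ := ⌈ℓ₁⌉₊ + ⌈ℓ₂⌉₊ with hLdef
  set γ : ℕ → ℂ := fun n' => if (Squarefree n' ∧ n'.Coprime b) then β (b * n') else 0 with hγ
  set G : ℝ := ∑ n' ∈ Icc 1 ⌊2 * (N / b)⌋₊, ‖γ n'‖ ^ 2 with hG
  have hG0 : 0 ≤ G := Finset.sum_nonneg fun n _ => by positivity
  have hM0 : 0 < M := by linarith
  have hN0 : 0 < N := by linarith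
  have hb0 : (0 : ℝ) < b := by exact_mod_cast hb
  have hb1 : (1 : ℝ) ≤ b := by exact_mod_cast hb
  have hMN1 : 1 ≤ M + N := by linarith
  have hℓ₁0 : 0 < ℓ₁ := by rw [hℓ₁]; positivity
  have hℓ₂0 : 0 < ℓ₂ := by rw [hℓ₂]; positivity
  -- the case `(b, k) > 1`: `γ_b = 0`
  by_cases hkb : k.natAbs.Coprime b
  swap
  · have hγ0 : ∀ n', γ n' = 0 := by
      intro n'
      simp only [hγ]
      split_ifs with h
      · by_contra hne
        have := (hβ (b * n') hne).2.2
        exact hkb (Nat.Coprime.coprime_mul_right this).symm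
      · rfl
    have hin : ∀ m, kfInner k b (N / b) γ m = 0 := by
      intro m
      unfold kfInner kfCoeff
      exact Finset.sum_eq_zero fun n _ => by rw [hγ0 n, zero_mul]
    have : ∑ m ∈ (Ioc ⌊M⌋₊ ⌊2 * M⌋₊).filter (fun m => m.Coprime b),
        ‖kfInner k b (N / b) γ m‖ ^ 2 = 0 :=
      Finset.sum_eq_zero fun m _ => by rw [hin m]; simp
    rw [this, mul_zero]
    positivity
  -- sizes of `ℓ₁, ℓ₂, L`
  have hk1 : (1 : ℝ) ≤ k.natAbs := by exact_mod_cast Int.natAbs_pos.mpr hk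
  have hΛ0 : 0 ≤ Real.log b + Real.log k.natAbs + Real.log ⌊2 * M⌋₊ := by
    have h1 : 0 ≤ Real.log b := Real.log_nonneg hb1
    have h2 : 0 ≤ Real.log k.natAbs := Real.log_nonneg hk1
    have h3 : 0 ≤ Real.log ⌊2 * M⌋₊ := Real.log_nonneg (by
      have : (2 : ℕ) ≤ ⌊2 * M⌋₊ := Nat.le_floor (by push_cast; linarith)
      exact_mod_cast (by omega : 1 ≤ ⌊2 * M⌋₊))
    linarith
  have hℓ₁big : (L₀ : ℝ) + 2 ≤ ℓ₁ := by linarith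
  have hL₁ : ℓ₁ ≤ L := by
    rw [hLdef]; push_cast
    exact (Nat.le_ceil ℓ₁).trans (by linarith [(Nat.cast_nonneg ⌈ℓ₂⌉₊ : (0:ℝ) ≤ ⌈ℓ₂⌉₊)])
  have hL₂ : ℓ₂ ≤ L := by
    rw [hLdef]; push_cast
    exact (Nat.le_ceil ℓ₂).trans (by linarith [(Nat.cast_nonneg ⌈ℓ₁⌉₊ : (0:ℝ) ≤ ⌈ℓ₁⌉₊)])
  have hLnat : L₀ + 2 ≤ L := by
    have : ((L₀ + 2 : ℕ) : ℝ) ≤ L := by push_cast; linarith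
    exact_mod_cast this
  have hL0' : L₀ ≤ L := by omega
  have hL2 : 2 ≤ L := by omega
  have hLR2 : (2 : ℝ) ≤ L := by exact_mod_cast hL2
  have hLpos : (0 : ℝ) < L := by linarith
  have hΛ : 4 * (Real.log b + Real.log k.natAbs + Real.log ⌊2 * M⌋₊) ≤ L := by linarith
  have hLup : (L : ℝ) ≤ ℓ₁ + ℓ₂ + 2 := by
    rw [hLdef]; push_cast
    have h1 := (Nat.ceil_lt_add_one hℓ₁0.le).le
    have h2 := (Nat.ceil_lt_add_one hℓ₂0.le).le
    linarith
  have hLle : (L : ℝ) ≤ 8 * max ℓ₁ ℓ₂ := by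
    have h1 : ℓ₁ ≤ max ℓ₁ ℓ₂ := le_max_left _ _
    have h2 : ℓ₂ ≤ max ℓ₁ ℓ₂ := le_max_right _ _
    have h3 : (2 : ℝ) ≤ ℓ₁ := by
      have : (0 : ℝ) ≤ L₀ := Nat.cast_nonneg _
      linarith
    linarith
  -- crude bounds `ℓ₁, ℓ₂ ≤ M + N`, `L ≤ 4 (M + N)`
  have hbleN : (b : ℝ) ≤ N := by nlinarith
  have hℓ₁le : ℓ₁ ≤ M + N := by
    have hX : (b : ℝ) ^ 3 * M ^ 4 / N ^ 3 ≤ (M + N) ^ (8 : ℕ) := by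
      rw [div_le_iff₀ (by positivity)]
      have h1 : (b : ℝ) ^ 3 ≤ N ^ 3 := pow_le_pow_left₀ hb0.le hbleN 3
      have h2 : M ^ 4 ≤ (M + N) ^ 4 := pow_le_pow_left₀ hM0.le (by linarith) 4
      have h3 : (M + N) ^ 4 ≤ (M + N) ^ 8 := pow_le_pow_right₀ hMN1 (by norm_num)
      calc (b : ℝ) ^ 3 * M ^ 4 ≤ N ^ 3 * (M + N) ^ 8 :=
            mul_le_mul h1 (h2.trans h3) (by positivity) (by positivity)
        _ = (M + N) ^ 8 * N ^ 3 := by ring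
    have := Real.rpow_le_rpow (by positivity) hX (by norm_num : (0:ℝ) ≤ 1 / 8)
    rw [show (1 / 8 : ℝ) = ((8 : ℕ) : ℝ)⁻¹ by norm_num, Real.pow_rpow_inv_natCast (by positivity)
      (by norm_num)] at this
    rw [hℓ₁, show (1 / 8 : ℝ) = ((8 : ℕ) : ℝ)⁻¹ by norm_num]
    exact this
  have hℓ₂le : ℓ₂ ≤ M + N := by
    have hX : (b : ℝ) ^ 5 * M ^ 8 / N ^ 7 ≤ (M + N) ^ (10 : ℕ) := by
      rw [div_le_iff₀ (by positivity)]
      have h1 : (b : ℝ) ^ 5 ≤ N ^ 5 := pow_le_pow_left₀ hb0.le hbleN 5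
      have h2 : M ^ 8 ≤ (M + N) ^ 8 := pow_le_pow_left₀ hM0.le (by linarith) 8
      have h3 : (M + N) ^ 8 ≤ (M + N) ^ 10 := pow_le_pow_right₀ hMN1 (by norm_num)
      have h4 : N ^ 5 ≤ N ^ 7 := pow_le_pow_right₀ hN (by norm_num)
      calc (b : ℝ) ^ 5 * M ^ 8 ≤ N ^ 7 * (M + N) ^ 10 :=
            mul_le_mul (h1.trans h4) (h2.trans h3) (by positivity) (by positivity)
        _ = (M + N) ^ 10 * N ^ 7 := by ring
    have := Real.rpow_le_rpow (by positivity) hX (by norm_num : (0:ℝ) ≤ 1 / 10)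
    rw [show (1 / 10 : ℝ) = ((10 : ℕ) : ℝ)⁻¹ by norm_num, Real.pow_rpow_inv_natCast (by positivity)
      (by norm_num)] at this
    rw [hℓ₂, show (1 / 10 : ℝ) = ((10 : ℕ) : ℝ)⁻¹ by norm_num]
    exact this
  have hL4 : (L : ℝ) ≤ 4 * (M + N) := by linarith
  -- the range of the divisor bound
  have hrange : 16 * (L : ℝ) ^ 2 * (N / b + (⌈4 * (L : ℝ) * (N / b) / ((⌊M⌋₊ : ℝ) + 1)⌉₊ : ℝ)) +
      2 * b * (N / b) ≤ 5000 * (M + N) ^ 4 := by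
    have hNb : N / b ≤ M + N := (div_le_self hN0.le hb1).trans (by linarith)
    have hceil : (⌈4 * (L : ℝ) * (N / b) / ((⌊M⌋₊ : ℝ) + 1)⌉₊ : ℝ) ≤ 17 * (M + N) ^ 2 := by
      have h1 : 4 * (L : ℝ) * (N / b) / ((⌊M⌋₊ : ℝ) + 1) ≤ 4 * (L : ℝ) * (N / b) :=
        div_le_self (by positivity) (by
          have : (0:ℝ) ≤ ⌊M⌋₊ := Nat.cast_nonneg _
          linarith)
      have h2 : 4 * (L : ℝ) * (N / b) ≤ 16 * (M + N) ^ 2 := by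
        calc 4 * (L : ℝ) * (N / b) ≤ 4 * (4 * (M + N)) * (M + N) :=
              mul_le_mul (by linarith) hNb (by positivity) (by positivity)
          _ = 16 * (M + N) ^ 2 := by ring
      have h3 := (Nat.ceil_lt_add_one (show (0:ℝ) ≤ 4 * (L : ℝ) * (N / b) / ((⌊M⌋₊ : ℝ) + 1) by
        positivity)).le
      nlinarith
    have h2N : 2 * (b : ℝ) * (N / b) = 2 * N := by field_simp
    rw [h2N]
    have hL2' : (L : ℝ) ^ 2 ≤ 16 * (M + N) ^ 2 := by nlinarith
    have hMN2 : 1 ≤ (M + N) ^ 2 := one_le_pow₀ hMN1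
    have hMN4 : (M + N) ^ 2 ≤ (M + N) ^ 4 := pow_le_pow_right₀ hMN1 (by norm_num)
    nlinarith [mul_le_mul hL2' (add_le_add hNb hceil) (by positivity) (by positivity)]
  have hT'' : ∀ w : ℕ, 1 ≤ w → (w : ℝ) ≤ 16 * (L : ℝ) ^ 2 *
      (N / b + (⌈4 * (L : ℝ) * (N / b) / ((⌊M⌋₊ : ℝ) + 1)⌉₊ : ℝ)) + 2 * b * (N / b) →
      (w.divisors.card : ℝ) ≤ T' := fun w hw hw' => hT' w hw (hw'.trans hrange)
  -- the explicit bound for `𝓒_b`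
  have hCb := kfm_Cb_explicit k hk hb hkb β hM hN hbN hβ hL₀ hL0' hL2 hΛ hT''
  -- the slowly varying factors
  have hT'1 : 1 ≤ T' := by
    have h := hT' 1 le_rfl (by push_cast; nlinarith [one_le_pow₀ (n := 4) hMN1])
    simpa using h
  have hlog2lo : (0.6931471803 : ℝ) < Real.log 2 := Real.log_two_gt_d9
  have hlog2hi : Real.log 2 < (0.6931471808 : ℝ) := Real.log_two_lt_d9
  have hlogMN : 0 ≤ Real.log (M + N) := Real.log_nonneg hMN1
  have hlogL : Real.log L ≤ S := by
    have h1 : Real.log L ≤ Real.log (4 * (M + N)) := Real.log_le_log hLpos hL4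
    rw [Real.log_mul (by norm_num) (by positivity),
      show (4 : ℝ) = 2 ^ 2 by norm_num, Real.log_pow] at h1
    push_cast at h1
    linarith
  have hlogL2 : Real.log 2 ≤ Real.log L := Real.log_le_log (by norm_num) hLR2
  have hR : Real.log (2 * N) / Real.log L ≤ S := by
    have h1 : Real.log (2 * N) ≤ Real.log 2 + Real.log (M + N) := by
      rw [← Real.log_mul (by norm_num) (by positivity)]
      exact Real.log_le_log (by positivity) (by linarith)
    have h2 : Real.log (2 * N) / Real.log L ≤ (Real.log 2 + Real.log (M + N)) / Real.log 2 :=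
      div_le_div₀ (by linarith) h1 (by linarith) hlogL2
    have h3 : (Real.log 2 + Real.log (M + N)) / Real.log 2 = 1 + Real.log (M + N) / Real.log 2 := by
      field_simp
    have h4 : Real.log (M + N) / Real.log 2 ≤ 2 * Real.log (M + N) := by
      rw [div_le_iff₀ (by linarith)]; nlinarith
    linarith
  have hl4 : 1 + Real.log (4 * ((L : ℝ) * N)) ≤ S := by
    have h1 : 4 * ((L : ℝ) * N) ≤ 16 * (M + N) ^ 2 := by nlinarith
    have h2 : Real.log (4 * ((L : ℝ) * N)) ≤ Real.log (16 * (M + N) ^ 2) :=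
      Real.log_le_log (by positivity) h1
    have h3 : Real.log (16 * (M + N) ^ 2) = 4 * Real.log 2 + 2 * Real.log (M + N) := by
      rw [Real.log_mul (by norm_num) (by positivity), Real.log_pow,
        show (16 : ℝ) = 2 ^ 4 by norm_num, Real.log_pow]
      push_cast; ring
    linarith
  have hl8 : 1 + Real.log (8 * (L : ℝ) ^ 2 * N) ≤ S := by
    have h1 : 8 * (L : ℝ) ^ 2 * N ≤ 128 * (M + N) ^ 3 := by
      have : (L : ℝ) ^ 2 ≤ 16 * (M + N) ^ 2 := by nlinarith
      nlinarith
    have h2 : Real.log (8 * (L : ℝ) ^ 2 * N) ≤ Real.log (128 * (M + N) ^ 3) :=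
      Real.log_le_log (by positivity) h1
    have h3 : Real.log (128 * (M + N) ^ 3) = 7 * Real.log 2 + 3 * Real.log (M + N) := by
      rw [Real.log_mul (by norm_num) (by positivity), Real.log_pow,
        show (128 : ℝ) = 2 ^ 7 by norm_num, Real.log_pow]
      push_cast; ring
    linarith
  have hF₀ : 1 ≤ 1 + 64 * Real.pi * |(k : ℝ)| / (M * N) := by
    have : 0 ≤ 64 * Real.pi * |(k : ℝ)| / (M * N) := by positivity
    linarith
  have hterms := kfm_bound_le_terms (L := (L : ℝ)) (b := (b : ℝ)) hM hN hb1 hLR2 hS1 (by linarith)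
    hST hlogL hR hl4 hl8 hF₀
  have htgt := kfm_terms_le_tgt (L := (L : ℝ)) hM hN hb1 hbN hw1 hw2 hℓ₁ hℓ₂ hL₁ hL₂ hLle
  -- combine
  have hsb0 : 0 ≤ Real.sqrt (b : ℝ) := Real.sqrt_nonneg _
  calc Real.sqrt b * ∑ m ∈ (Ioc ⌊M⌋₊ ⌊2 * M⌋₊).filter (fun m => m.Coprime b),
        ‖kfInner k b (N / b) γ m‖ ^ 2 ≤ Real.sqrt b * (G * _) := mul_le_mul_of_nonneg_left hCb hsb0
    _ = G * (Real.sqrt b * _) := by ring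
    _ ≤ G * (S ^ 6 * Real.sqrt (1 + 64 * Real.pi * |(k : ℝ)| / (M * N)) * _) :=
        mul_le_mul_of_nonneg_left hterms hG0
    _ ≤ G * (S ^ 6 * Real.sqrt (1 + 64 * Real.pi * |(k : ℝ)| / (M * N)) *
        (230000 * ((M * N) ^ (3 / 4 : ℝ) * (M + N) ^ (11 / 24 : ℝ)))) :=
        mul_le_mul_of_nonneg_left (mul_le_mul_of_nonneg_left htgt (by positivity)) hG0
    _ = _ := by ring

/-! ### The main regime -/

set_option maxHeartbeats 2000000 in
/-- **`𝓒₁` in the main regime**: summing `kff_main_b` over the square-full `b ≤ N^{1/2}` and the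
trivial bound over `b > N^{1/2}` (`kfCb_triv`), with `Σ_b ‖γ_b‖² = ‖β‖²` and
`H ≤ T'(1 + log 2N) ≤ S²`:  `𝓒₁ ≤ 230000 S⁸ F₀^{1/2} (MN)^{3/4}(M+N)^{11/24} ‖β‖²`.
[cite: BettinChandee2018, §6] -/
theorem kff_C1_main (k : ℤ) (hk : k ≠ 0) (β : ℕ → ℂ) {M N : ℝ}
    (hM : 1 ≤ M) (hN : 1 ≤ N) (hw1 : N ^ 5 ≤ M ^ 6) (hw2 : M ^ 5 ≤ N ^ 6)
    (hβ : ∀ n, β n ≠ 0 → N < n ∧ (n : ℝ) ≤ 2 * N ∧ n.Coprime k.natAbs)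
    {L₀ : ℕ} (hL₀ : ∀ L : ℕ, L₀ ≤ L →
      (L : ℝ) / (2 * Real.log L) ≤ (((Finset.Ioc L (2 * L)).filter Nat.Prime).card : ℝ))
    (hbig : (L₀ : ℝ) + 2 + 4 * (Real.log N / 2 + Real.log k.natAbs + Real.log ⌊2 * M⌋₊) ≤
      (M ^ 4 / N ^ 3) ^ (1 / 8 : ℝ))
    {T' S : ℝ} (hT' : ∀ w : ℕ, 1 ≤ w → (w : ℝ) ≤ 5000 * (M + N) ^ 4 → (w.divisors.card : ℝ) ≤ T')
    (hS1 : 1 ≤ S) (hST : T' ≤ S) (hSlog : 6 + 3 * Real.log (M + N) ≤ S) :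
    ∑ m ∈ Ioc ⌊M⌋₊ ⌊2 * M⌋₊, ‖∑ n ∈ Icc 1 ⌊2 * N⌋₊,
      (if m.Coprime n then
        β n * Complex.exp (2 * Real.pi * Complex.I *
          ((k : ℂ) * ((((m : ZMod n)⁻¹).val : ℕ) : ℂ) / (n : ℂ)))
      else 0)‖ ^ 2 ≤
      (∑ n ∈ Icc 1 ⌊2 * N⌋₊, ‖β n‖ ^ 2) *
        (230000 * S ^ 8 * Real.sqrt (1 + 64 * Real.pi * |(k : ℝ)| / (M * N)) *
          ((M * N) ^ (3 / 4 : ℝ) * (M + N) ^ (11 / 24 : ℝ))) := by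
  set Bset := (Icc 1 ⌊2 * N⌋₊).filter (fun b => ∀ p ∈ b.primeFactors, p ^ 2 ∣ b) with hBset
  set F₀ : ℝ := 1 + 64 * Real.pi * |(k : ℝ)| / (M * N) with hF₀
  set TGT : ℝ := (M * N) ^ (3 / 4 : ℝ) * (M + N) ^ (11 / 24 : ℝ) with hTGT
  set W : ℝ := 230000 * S ^ 6 * Real.sqrt F₀ * TGT with hW
  set γ : ℕ → ℕ → ℂ := fun b n' => if (Squarefree n' ∧ n'.Coprime b) then β (b * n') else 0 with hγ
  set Gb : ℕ → ℝ := fun b => ∑ n' ∈ Icc 1 ⌊2 * (N / b)⌋₊, ‖γ b n'‖ ^ 2 with hGb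
  have hM0 : 0 < M := by linarith
  have hN0 : 0 < N := by linarith
  have hMN1 : 1 ≤ M + N := by linarith
  have hTGT0 : 0 < TGT := by rw [hTGT]; positivity
  have hsF : 1 ≤ Real.sqrt F₀ := by
    have : (1:ℝ) ≤ F₀ := by
      rw [hF₀]
      have : 0 ≤ 64 * Real.pi * |(k : ℝ)| / (M * N) := by positivity
      linarith
    have h := Real.sqrt_le_sqrt this
    rwa [Real.sqrt_one] at h
  have hW4 : 4 * TGT ≤ W := by
    rw [hW]
    have h1 : (4 : ℝ) ≤ 230000 * S ^ 6 * Real.sqrt F₀ := by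
      have : (1 : ℝ) ≤ S ^ 6 := one_le_pow₀ hS1
      nlinarith
    exact mul_le_mul_of_nonneg_right h1 hTGT0.le
  have hW0 : 0 ≤ W := by linarith [hW4, hTGT0]
  have hGb0 : ∀ b, 0 ≤ Gb b := fun b => Finset.sum_nonneg fun n _ => by positivity
  -- per `b`
  have hper : ∀ b ∈ Bset, Real.sqrt (b : ℝ) *
      ∑ m ∈ (Ioc ⌊M⌋₊ ⌊2 * M⌋₊).filter (fun m => m.Coprime b), ‖kfInner k b (N / b) (γ b) m‖ ^ 2 ≤
      Gb b * W := by
    intro b hb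
    have hbI := Finset.mem_Icc.mp (Finset.mem_filter.mp hb).1
    have hb0 : 0 < b := hbI.1
    have hbR : (1 : ℝ) ≤ b := by exact_mod_cast hb0
    have hb2N : (b : ℝ) ≤ 2 * N := (Nat.cast_le.mpr hbI.2).trans (Nat.floor_le (by linarith))
    by_cases hbN : (b : ℝ) ^ 2 ≤ N
    · -- main regime for `b`
      have hbig' : (L₀ : ℝ) + 2 + 4 * (Real.log b + Real.log k.natAbs + Real.log ⌊2 * M⌋₊) ≤
          ((b : ℝ) ^ 3 * M ^ 4 / N ^ 3) ^ (1 / 8 : ℝ) := by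
        have h1 : Real.log b ≤ Real.log N / 2 := by
          have := Real.log_le_log (by positivity) hbN
          rw [Real.log_pow] at this; push_cast at this; linarith
        have h2 : (M ^ 4 / N ^ 3) ^ (1 / 8 : ℝ) ≤ ((b : ℝ) ^ 3 * M ^ 4 / N ^ 3) ^ (1 / 8 : ℝ) := by
          refine Real.rpow_le_rpow (by positivity) ?_ (by norm_num)
          refine div_le_div_of_nonneg_right ?_ (by positivity)
          have : (1 : ℝ) ≤ (b : ℝ) ^ 3 := one_le_pow₀ hbR
          nlinarith [pow_pos hM0 4]
        linarith
      have h := kff_main_b k hk hb0 β hM hN hbN hw1 hw2 hβ hL₀ hbig' hT' hS1 hST hSlog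
      rw [hGb, hW, hF₀, hTGT]
      exact h
    · -- `b > N^{1/2}`: trivial bound
      push Not at hbN
      have hNb0 : 0 ≤ N / b := by positivity
      have h1 := kfCb_triv k b hNb0 (γ b) (Nat.floor_le_floor (by linarith : M ≤ 2 * M))
      have hdiff : ((⌊2 * M⌋₊ : ℕ) : ℝ) - (⌊M⌋₊ : ℕ) ≤ 2 * M := by
        have h2 : ((⌊2 * M⌋₊ : ℕ) : ℝ) ≤ 2 * M := Nat.floor_le (by linarith)
        have h3 : (0 : ℝ) ≤ (⌊M⌋₊ : ℕ) := Nat.cast_nonneg _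
        linarith
      have h2 : ∑ m ∈ (Ioc ⌊M⌋₊ ⌊2 * M⌋₊).filter (fun m => m.Coprime b),
          ‖kfInner k b (N / b) (γ b) m‖ ^ 2 ≤ 2 * M * (2 * (N / b) * Gb b) :=
        h1.trans (mul_le_mul_of_nonneg_right hdiff (by positivity))
      -- `√b · 2M · 2(N/b) = 4MN/√b ≤ 4 TGT`
      have hsb : 0 < Real.sqrt (b : ℝ) := Real.sqrt_pos.mpr (by positivity)
      have hkey : Real.sqrt (b : ℝ) * (2 * M * (2 * (N / b))) ≤ 4 * TGT := by
        have e : Real.sqrt (b : ℝ) * (2 * M * (2 * (N / b))) = 4 * (M * N / Real.sqrt b) := by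
          have hb2 : Real.sqrt (b : ℝ) * Real.sqrt b = b := Real.mul_self_sqrt (by positivity)
          field_simp
          nlinarith [hb2]
        rw [e]
        refine mul_le_mul_of_nonneg_left ?_ (by norm_num)
        -- logs
        rw [← Real.log_le_log_iff (by positivity) hTGT0, Real.log_div (by positivity) hsb.ne',
          Real.log_mul hM0.ne' hN0.ne', Real.log_sqrt (by positivity), hTGT,
          Real.log_mul (by positivity) (by positivity), Real.log_rpow (by positivity),
          Real.log_rpow (by positivity), Real.log_mul hM0.ne' hN0.ne']
        have hx : 0 ≤ Real.log M := Real.log_nonneg hM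
        have hzy : Real.log N ≤ 2 * Real.log b := by
          have := Real.log_le_log hN0 hbN.le
          rw [Real.log_pow] at this; push_cast at this; linarith
        have htx : Real.log M ≤ Real.log (M + N) := Real.log_le_log hM0 (by linarith)
        linarith
      calc Real.sqrt (b : ℝ) * _ ≤ Real.sqrt (b : ℝ) * (2 * M * (2 * (N / b) * Gb b)) :=
            mul_le_mul_of_nonneg_left h2 hsb.le
        _ = (Real.sqrt (b : ℝ) * (2 * M * (2 * (N / b)))) * Gb b := by ring
        _ ≤ (4 * TGT) * Gb b := mul_le_mul_of_nonneg_right hkey (hGb0 b)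
        _ ≤ W * Gb b := mul_le_mul_of_nonneg_right hW4 (hGb0 b)
        _ = Gb b * W := by ring
  -- `H ≤ S²`
  have hT'τ : ∀ a ∈ Icc 1 ⌊2 * N⌋₊, (a.divisors.card : ℝ) ≤ T' := by
    intro a ha
    have ha' := Finset.mem_Icc.mp ha
    refine hT' a ha'.1 ?_
    have h1 : (a : ℝ) ≤ 2 * N := (Nat.cast_le.mpr ha'.2).trans (Nat.floor_le (by linarith))
    have h2 : M + N ≤ (M + N) ^ 4 := le_self_pow₀ hMN1 (by norm_num)
    linarith
  have hT'0 : 0 ≤ T' := by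
    have := hT'τ 1 (Finset.mem_Icc.mpr ⟨le_rfl, Nat.le_floor (by push_cast; linarith)⟩)
    simp at this; linarith
  have hH : ∑ b ∈ Bset, 1 / Real.sqrt (b : ℝ) ≤ S ^ 2 := by
    have h1 := sqf_sum_rsqrt_le ⌊2 * N⌋₊ hT'0 hT'τ
    have h2 : 1 + Real.log (⌊2 * N⌋₊ : ℕ) ≤ S := by
      have h3 : Real.log (⌊2 * N⌋₊ : ℕ) ≤ Real.log (2 * (M + N)) := by
        refine Real.log_le_log ?_ ((Nat.floor_le (by linarith)).trans (by linarith))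
        exact_mod_cast Nat.floor_pos.mpr (by linarith)
      rw [Real.log_mul (by norm_num) (by positivity)] at h3
      have : Real.log 2 < 0.6931471808 := Real.log_two_lt_d9
      have : 0 ≤ Real.log (M + N) := Real.log_nonneg hMN1
      linarith
    calc _ ≤ T' * (1 + Real.log (⌊2 * N⌋₊ : ℕ)) := h1
      _ ≤ S * S := mul_le_mul hST h2 (by
          have : (0:ℝ) ≤ Real.log (⌊2 * N⌋₊ : ℕ) := Real.log_natCast_nonneg _
          linarith) (by linarith)
      _ = S ^ 2 := (sq S).symm
  -- assemble
  have hC1 := kfC1_le_sum_Cb k N β M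
  have hsum : ∑ b ∈ Bset, Real.sqrt (b : ℝ) *
      ∑ m ∈ (Ioc ⌊M⌋₊ ⌊2 * M⌋₊).filter (fun m => m.Coprime b), ‖kfInner k b (N / b) (γ b) m‖ ^ 2 ≤
      (∑ n ∈ Icc 1 ⌊2 * N⌋₊, ‖β n‖ ^ 2) * W := by
    calc _ ≤ ∑ b ∈ Bset, Gb b * W := Finset.sum_le_sum hper
      _ = (∑ b ∈ Bset, Gb b) * W := by rw [Finset.sum_mul]
      _ = (∑ n ∈ Icc 1 ⌊2 * N⌋₊, ‖β n‖ ^ 2) * W := by rw [hGb, hγ, sqf_sum_norm_sq N β]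
  have hB0 : 0 ≤ ∑ n ∈ Icc 1 ⌊2 * N⌋₊, ‖β n‖ ^ 2 := Finset.sum_nonneg fun n _ => by positivity
  calc _ ≤ (∑ b ∈ Bset, 1 / Real.sqrt (b : ℝ)) * _ := hC1
    _ ≤ S ^ 2 * ((∑ n ∈ Icc 1 ⌊2 * N⌋₊, ‖β n‖ ^ 2) * W) :=
        mul_le_mul hH hsum (Finset.sum_nonneg fun b _ => mul_nonneg (Real.sqrt_nonneg _)
          (Finset.sum_nonneg fun m _ => by positivity)) (by positivity)
    _ = _ := by rw [hW]; ring

/-- `(F₀^{1/2} (MN)^{3/4}(M+N)^{11/24})^{1/2} ≤ 4 (|k|+MN)^{3/8} (M+N)^{11/48}`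
(`F₀ = 1 + 64π|k|/(MN) ≤ 256(|k|+MN)/(MN)`). [folklore] -/
theorem kff_kfactor_le (k : ℤ) {M N : ℝ} (hM : 0 < M) (hN : 0 < N) :
    Real.sqrt (Real.sqrt (1 + 64 * Real.pi * |(k : ℝ)| / (M * N)) *
      ((M * N) ^ (3 / 4 : ℝ) * (M + N) ^ (11 / 24 : ℝ))) ≤
      4 * ((|(k : ℝ)| + M * N) ^ (3 / 8 : ℝ) * (M + N) ^ (11 / 48 : ℝ)) := by
  set A : ℝ := |(k : ℝ)| + M * N with hA
  set F : ℝ := 1 + 64 * Real.pi * |(k : ℝ)| / (M * N) with hFdef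
  have hA0 : 0 < A := by rw [hA]; positivity
  have hF0 : 0 < F := by rw [hFdef]; positivity
  have hF : F ≤ 256 * A / (M * N) := by
    rw [hFdef, le_div_iff₀ (by positivity)]
    have e : (1 + 64 * Real.pi * |(k : ℝ)| / (M * N)) * (M * N) = M * N + 64 * Real.pi * |(k : ℝ)| := by
      field_simp
    rw [e, hA]
    have hpi : Real.pi ≤ 4 := Real.pi_le_four
    have hk0 : 0 ≤ |(k : ℝ)| := abs_nonneg _
    have hMN0 : 0 < M * N := by positivity
    nlinarith
  have hlhs0 : 0 < Real.sqrt F * ((M * N) ^ (3 / 4 : ℝ) * (M + N) ^ (11 / 24 : ℝ)) := by positivity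
  have hrhs0 : 0 < 4 * (A ^ (3 / 8 : ℝ) * (M + N) ^ (11 / 48 : ℝ)) := by positivity
  rw [Real.sqrt_le_left hrhs0.le, ← Real.log_le_log_iff hlhs0 (by positivity)]
  have eL : Real.log (Real.sqrt F * ((M * N) ^ (3 / 4 : ℝ) * (M + N) ^ (11 / 24 : ℝ))) =
      Real.log F / 2 + (3 / 4 * Real.log (M * N) + 11 / 24 * Real.log (M + N)) := by
    rw [Real.log_mul (by positivity) (by positivity), Real.log_sqrt hF0.le,
      Real.log_mul (by positivity) (by positivity), Real.log_rpow (by positivity),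
      Real.log_rpow (by positivity)]
  have eR : Real.log ((4 * (A ^ (3 / 8 : ℝ) * (M + N) ^ (11 / 48 : ℝ))) ^ 2) =
      2 * (Real.log 4 + (3 / 8 * Real.log A + 11 / 48 * Real.log (M + N))) := by
    rw [Real.log_pow, Real.log_mul (by norm_num) (by positivity),
      Real.log_mul (by positivity) (by positivity), Real.log_rpow hA0, Real.log_rpow (by positivity)]
    push_cast; ring
  rw [eL, eR]
  have h1 : Real.log F ≤ Real.log 256 + Real.log A - Real.log (M * N) := by
    have := Real.log_le_log hF0 hF
    rw [Real.log_div (by positivity) (by positivity), Real.log_mul (by norm_num) hA0.ne'] at this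
    exact this
  have h2 : Real.log (M * N) ≤ Real.log A := Real.log_le_log (by positivity) (by
    rw [hA]; linarith [abs_nonneg (k : ℝ)])
  have h3 : Real.log 256 = 4 * Real.log 4 := by
    rw [show (256 : ℝ) = 4 ^ 4 by norm_num, Real.log_pow]; push_cast; ring
  linarith

/-- **`𝓑` in the main regime**: `‖𝓑‖ ≤ 1920 S⁴ ‖α‖ ‖β‖ (|k|+MN)^{3/8} (M+N)^{11/48}`.
[cite: DukeFriedlanderIwaniec1997, Theorem 2] -/
theorem kff_B_main (k : ℤ) (hk : k ≠ 0) (α β : ℕ → ℂ) {M N : ℝ}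
    (hM : 1 ≤ M) (hN : 1 ≤ N) (hw1 : N ^ 5 ≤ M ^ 6) (hw2 : M ^ 5 ≤ N ^ 6)
    (hα : ∀ m : ℕ, α m ≠ 0 → M < m ∧ (m : ℝ) ≤ 2 * M)
    (hβ : ∀ n, β n ≠ 0 → N < n ∧ (n : ℝ) ≤ 2 * N ∧ n.Coprime k.natAbs)
    {L₀ : ℕ} (hL₀ : ∀ L : ℕ, L₀ ≤ L →
      (L : ℝ) / (2 * Real.log L) ≤ (((Finset.Ioc L (2 * L)).filter Nat.Prime).card : ℝ))
    (hbig : (L₀ : ℝ) + 2 + 4 * (Real.log N / 2 + Real.log k.natAbs + Real.log ⌊2 * M⌋₊) ≤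
      (M ^ 4 / N ^ 3) ^ (1 / 8 : ℝ))
    {T' S : ℝ} (hT' : ∀ w : ℕ, 1 ≤ w → (w : ℝ) ≤ 5000 * (M + N) ^ 4 → (w.divisors.card : ℝ) ≤ T')
    (hS1 : 1 ≤ S) (hST : T' ≤ S) (hSlog : 6 + 3 * Real.log (M + N) ≤ S) :
    ‖∑ m ∈ Icc 1 ⌊2 * M⌋₊, ∑ n ∈ Icc 1 ⌊2 * N⌋₊,
        if m.Coprime n then
          α m * β n * Complex.exp (2 * Real.pi * Complex.I *
            ((k : ℂ) * ((((m : ZMod n)⁻¹).val : ℕ) : ℂ) / (n : ℂ)))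
        else 0‖ ≤
      1920 * S ^ 4 * Real.sqrt (∑ m ∈ Icc 1 ⌊2 * M⌋₊, ‖α m‖ ^ 2) *
        Real.sqrt (∑ n ∈ Icc 1 ⌊2 * N⌋₊, ‖β n‖ ^ 2) *
        ((|(k : ℝ)| + M * N) ^ (3 / 8 : ℝ) * (M + N) ^ (11 / 48 : ℝ)) := by
  have hM0 : 0 < M := by linarith
  have hN0 : 0 < N := by linarith
  have h1 : ‖∑ m ∈ Icc 1 ⌊2 * M⌋₊, ∑ n ∈ Icc 1 ⌊2 * N⌋₊,
      (if m.Coprime n then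
        α m * β n * Complex.exp (2 * Real.pi * Complex.I *
          ((k : ℂ) * ((((m : ZMod n)⁻¹).val : ℕ) : ℂ) / (n : ℂ)))
      else 0)‖ ≤
      Real.sqrt (∑ m ∈ Icc 1 ⌊2 * M⌋₊, ‖α m‖ ^ 2) *
        Real.sqrt (∑ m ∈ Ioc ⌊M⌋₊ ⌊2 * M⌋₊, ‖∑ n ∈ Icc 1 ⌊2 * N⌋₊,
          (if m.Coprime n then
            β n * Complex.exp (2 * Real.pi * Complex.I *
              ((k : ℂ) * ((((m : ZMod n)⁻¹).val : ℕ) : ℂ) / (n : ℂ)))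
          else 0)‖ ^ 2) := by
    rw [Finset.sum_congr rfl (fun m _ => kfB_factor N k α β m)]
    exact kfB_dyadic_CS M α _ hα
  have h2 := kff_C1_main k hk β hM hN hw1 hw2 hβ hL₀ hbig hT' hS1 hST hSlog
  have h3 := kff_kfactor_le k hM0 hN0
  set nα := Real.sqrt (∑ m ∈ Icc 1 ⌊2 * M⌋₊, ‖α m‖ ^ 2) with hnα
  set Bn := ∑ n ∈ Icc 1 ⌊2 * N⌋₊, ‖β n‖ ^ 2 with hBn
  set F₀ : ℝ := 1 + 64 * Real.pi * |(k : ℝ)| / (M * N) with hF₀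
  set TGT : ℝ := (M * N) ^ (3 / 4 : ℝ) * (M + N) ^ (11 / 24 : ℝ) with hTGT
  set Fin : ℝ := (|(k : ℝ)| + M * N) ^ (3 / 8 : ℝ) * (M + N) ^ (11 / 48 : ℝ) with hFin
  have hBn0 : 0 ≤ Bn := Finset.sum_nonneg fun n _ => by positivity
  have hS0 : 0 ≤ S := by linarith
  have hW : Real.sqrt (Bn * (230000 * S ^ 8 * Real.sqrt F₀ * TGT)) ≤
      Real.sqrt Bn * (480 * S ^ 4 * (4 * Fin)) := by
    rw [Real.sqrt_mul hBn0]
    refine mul_le_mul_of_nonneg_left ?_ (Real.sqrt_nonneg _)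
    have e : 230000 * S ^ 8 * Real.sqrt F₀ * TGT = (230000 * (S ^ 4) ^ 2) * (Real.sqrt F₀ * TGT) := by
      ring
    rw [e, Real.sqrt_mul (by positivity), Real.sqrt_mul (by norm_num), Real.sqrt_sq (by positivity)]
    have h480 : Real.sqrt 230000 ≤ 480 := by
      rw [Real.sqrt_le_left (by norm_num)]; norm_num
    calc Real.sqrt 230000 * S ^ 4 * Real.sqrt (Real.sqrt F₀ * TGT) ≤ 480 * S ^ 4 * (4 * Fin) :=
          mul_le_mul (mul_le_mul_of_nonneg_right h480 (by positivity)) h3 (Real.sqrt_nonneg _)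
            (by positivity)
      _ = _ := by ring
  calc _ ≤ nα * Real.sqrt _ := h1
    _ ≤ nα * Real.sqrt (Bn * (230000 * S ^ 8 * Real.sqrt F₀ * TGT)) :=
        mul_le_mul_of_nonneg_left (Real.sqrt_le_sqrt h2) (Real.sqrt_nonneg _)
    _ ≤ nα * (Real.sqrt Bn * (480 * S ^ 4 * (4 * Fin))) :=
        mul_le_mul_of_nonneg_left hW (Real.sqrt_nonneg _)
    _ = _ := by ring

/-! ### Thresholds and the trivial regime -/

open Filter in
/-- A growth threshold: `C + 17 log y ≤ (y/2)^{5/144}` for `y ≥ Y₀`. [folklore] -/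
theorem kff_threshold (C : ℝ) : ∃ Y₀ : ℝ, 2 ≤ Y₀ ∧ ∀ y : ℝ, Y₀ ≤ y →
    C + 17 * Real.log y ≤ (y / 2) ^ (5 / 144 : ℝ) := by
  have hr : (0 : ℝ) < 5 / 144 := by norm_num
  set c : ℝ := (1 / 2) * (2 : ℝ) ^ (-(5 / 144 : ℝ)) / 17 with hc
  have hc0 : 0 < c := by rw [hc]; positivity
  have h1 : ∀ᶠ y : ℝ in atTop, ‖Real.log y‖ ≤ c * ‖y ^ (5 / 144 : ℝ)‖ :=
    (isLittleO_log_rpow_atTop hr).bound hc0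
  have h2 : Tendsto (fun y : ℝ => (y / 2) ^ (5 / 144 : ℝ)) atTop atTop :=
    (tendsto_rpow_atTop hr).comp (tendsto_id.atTop_div_const (by norm_num : (0 : ℝ) < 2))
  have h3 : ∀ᶠ y : ℝ in atTop, 2 * C ≤ (y / 2) ^ (5 / 144 : ℝ) := h2.eventually_ge_atTop _
  have h4 : ∀ᶠ y : ℝ in atTop, (1 : ℝ) ≤ y := eventually_ge_atTop 1
  obtain ⟨a, ha⟩ := Filter.eventually_atTop.mp ((h1.and h3).and h4)
  refine ⟨max a 2, le_max_right _ _, fun y hy => ?_⟩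
  obtain ⟨⟨hy1, hy3⟩, hy4⟩ := ha y (le_of_max_le_left hy)
  have hy0 : 0 < y := by linarith
  have hlog : 0 ≤ Real.log y := Real.log_nonneg hy4
  rw [Real.norm_eq_abs, Real.norm_eq_abs, abs_of_nonneg hlog,
    abs_of_nonneg (by positivity)] at hy1
  have e : (y / 2) ^ (5 / 144 : ℝ) = y ^ (5 / 144 : ℝ) * (2 : ℝ) ^ (-(5 / 144 : ℝ)) := by
    rw [Real.div_rpow hy0.le (by norm_num), Real.rpow_neg (by norm_num), div_eq_mul_inv]
  have h5 : 17 * Real.log y ≤ (1 / 2) * (y / 2) ^ (5 / 144 : ℝ) := by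
    rw [e]
    have := mul_le_mul_of_nonneg_left hy1 (by norm_num : (0 : ℝ) ≤ 17)
    rw [hc] at this
    have hpos : 0 ≤ y ^ (5 / 144 : ℝ) * (2 : ℝ) ^ (-(5 / 144 : ℝ)) := by positivity
    nlinarith
  linarith

/-- **The trivial regime**: if `(MN)⁶ ≤ (M+N)¹¹` (outside the window `N^{5/6} ≤ M ≤ N^{6/5}`
with `M, N ≥ 1`, or `min(M,N) < 1`), or `(MN)⁴ ≤ |k|³`, or `M + N ≤ Y₀`, then
`(6MN)^{1/2} ≤ 6^{1/2} max(Y₀,1) (|k|+MN)^{3/8}(M+N)^{11/48}`. [folklore] -/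
theorem kff_triv_regime {M N Y₀ : ℝ} (hM : 1 / 2 ≤ M) (hN : 1 / 2 ≤ N) {k : ℤ} (hk : k ≠ 0)
    (h : (M * N) ^ 6 ≤ (M + N) ^ 11 ∨ (M * N) ^ 4 ≤ (k.natAbs : ℝ) ^ 3 ∨ M + N ≤ Y₀) :
    Real.sqrt (6 * M * N) ≤ Real.sqrt 6 * max Y₀ 1 *
      ((|(k : ℝ)| + M * N) ^ (3 / 8 : ℝ) * (M + N) ^ (11 / 48 : ℝ)) := by
  have hM0 : 0 < M := by linarith
  have hN0 : 0 < N := by linarith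
  have hy1 : 1 ≤ M + N := by linarith
  have hk1 : (1 : ℝ) ≤ |(k : ℝ)| := by
    rw [← Int.cast_abs]; exact_mod_cast Int.one_le_abs hk
  have hkabs : ((k.natAbs : ℕ) : ℝ) = |(k : ℝ)| := by
    rw [← Int.cast_natCast, Int.natCast_natAbs, Int.cast_abs]
  set A : ℝ := |(k : ℝ)| + M * N with hA
  have hA1 : 1 ≤ A := by rw [hA]; nlinarith
  have hA0 : 0 < A := by linarith
  have hApow : 1 ≤ A ^ (3 / 8 : ℝ) := Real.one_le_rpow hA1 (by norm_num)
  have hypow : 1 ≤ (M + N) ^ (11 / 48 : ℝ) := Real.one_le_rpow hy1 (by norm_num)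
  have hmax1 : 1 ≤ max Y₀ 1 := le_max_right _ _
  have hsqrt6 : Real.sqrt (6 * M * N) = Real.sqrt 6 * Real.sqrt (M * N) := by
    rw [show 6 * M * N = 6 * (M * N) by ring, Real.sqrt_mul (by norm_num)]
  rw [hsqrt6]
  have hs6 : 0 ≤ Real.sqrt 6 := Real.sqrt_nonneg _
  rw [mul_assoc]
  refine mul_le_mul_of_nonneg_left ?_ hs6
  rcases h with h | h | h
  · -- `(MN)⁶ ≤ (M+N)¹¹`
    have key : Real.sqrt (M * N) ≤ A ^ (3 / 8 : ℝ) * (M + N) ^ (11 / 48 : ℝ) := by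
      have eR : Real.log (A ^ (3 / 8 : ℝ) * (M + N) ^ (11 / 48 : ℝ)) =
          3 / 8 * Real.log A + 11 / 48 * Real.log (M + N) := by
        rw [Real.log_mul (by positivity) (by positivity), Real.log_rpow hA0,
          Real.log_rpow (by positivity)]
      rw [← Real.log_le_log_iff (by positivity) (by positivity), Real.log_sqrt (by positivity), eR]
      have h1 : Real.log (M * N) ≤ Real.log A :=
        Real.log_le_log (by positivity) (by rw [hA]; linarith [abs_nonneg (k : ℝ)])
      have h2 : 6 * Real.log (M * N) ≤ 11 * Real.log (M + N) := by
        have := Real.log_le_log (by positivity) h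
        rw [Real.log_pow, Real.log_pow] at this
        exact_mod_cast this
      linarith
    calc Real.sqrt (M * N) ≤ A ^ (3 / 8 : ℝ) * (M + N) ^ (11 / 48 : ℝ) := key
      _ ≤ max Y₀ 1 * (A ^ (3 / 8 : ℝ) * (M + N) ^ (11 / 48 : ℝ)) :=
          le_mul_of_one_le_left (by positivity) hmax1
  · -- `(MN)⁴ ≤ |k|³`
    rw [hkabs] at h
    have key : Real.sqrt (M * N) ≤ A ^ (3 / 8 : ℝ) := by
      rw [← Real.log_le_log_iff (by positivity) (by positivity), Real.log_sqrt (by positivity),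
        Real.log_rpow hA0]
      have h1 : Real.log |(k : ℝ)| ≤ Real.log A :=
        Real.log_le_log (by linarith) (by rw [hA]; nlinarith)
      have h2 : 4 * Real.log (M * N) ≤ 3 * Real.log |(k : ℝ)| := by
        have := Real.log_le_log (by positivity) h
        rw [Real.log_pow, Real.log_pow] at this
        exact_mod_cast this
      linarith
    calc Real.sqrt (M * N) ≤ A ^ (3 / 8 : ℝ) * 1 := by rw [mul_one]; exact key
      _ ≤ A ^ (3 / 8 : ℝ) * (M + N) ^ (11 / 48 : ℝ) := mul_le_mul_of_nonneg_left hypow (by positivity)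
      _ ≤ max Y₀ 1 * (A ^ (3 / 8 : ℝ) * (M + N) ^ (11 / 48 : ℝ)) :=
          le_mul_of_one_le_left (by positivity) hmax1
  · -- `M + N ≤ Y₀`
    have key : Real.sqrt (M * N) ≤ max Y₀ 1 := by
      rw [Real.sqrt_le_left (by positivity)]
      have h1 : M * N ≤ (M + N) ^ 2 := by nlinarith
      have h2 : M + N ≤ max Y₀ 1 := h.trans (le_max_left _ _)
      have h3 : (M + N) ^ 2 ≤ (max Y₀ 1) ^ 2 := pow_le_pow_left₀ (by linarith) h2 2
      linarith
    calc Real.sqrt (M * N) ≤ max Y₀ 1 * 1 := by rw [mul_one]; exact key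
      _ ≤ max Y₀ 1 * (A ^ (3 / 8 : ℝ) * (M + N) ^ (11 / 48 : ℝ)) :=
          mul_le_mul_of_nonneg_left (one_le_mul_of_one_le_of_one_le hApow hypow) (by positivity)

/-! ### The core bound (coprime support) -/

set_option maxHeartbeats 2000000 in
/-- **Theorem 2 of Duke–Friedlander–Iwaniec for `β` supported on integers coprime to `k`**
(B–C §§2–6 with `A = 1`), in the form required by `DFI_bilinear_bound_of_coprime_case`:
for `0 < ε ≤ 1` there is `K` with
`‖𝓑(M,N,k;α,β)‖ ≤ ‖α‖‖β‖ · K (|k| + |MN|)^{3/8} (|M|+|N|)^{11/48+ε}` for all `M, N ≥ 1/2`,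
`k ≠ 0`, `α` supported on `(M,2M]`, `β` on `(N,2N]` and on integers coprime to `k`.
[cite: DukeFriedlanderIwaniec1997, Theorem 2] -/
theorem kff_core {ε : ℝ} (hε : 0 < ε) (hε1 : ε ≤ 1) : ∃ K : ℝ, 0 < K ∧
    ∀ (M N : ℝ), 1 / 2 ≤ M → 1 / 2 ≤ N → ∀ (k : ℤ), k ≠ 0 → ∀ (α β : ℕ → ℂ),
      (∀ m : ℕ, α m ≠ 0 → M < m ∧ (m : ℝ) ≤ 2 * M) →
      (∀ n : ℕ, β n ≠ 0 → N < n ∧ (n : ℝ) ≤ 2 * N) →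
      (∀ n : ℕ, β n ≠ 0 → n.Coprime k.natAbs) →
      ‖∑ m ∈ Icc 1 ⌊2 * M⌋₊, ∑ n ∈ Icc 1 ⌊2 * N⌋₊,
          if m.Coprime n then
            α m * β n * Complex.exp (2 * Real.pi * Complex.I *
              ((k : ℂ) * ((((m : ZMod n)⁻¹).val : ℕ) : ℂ) / (n : ℂ)))
          else 0‖ ≤
        Real.sqrt (∑ m ∈ Icc 1 ⌊2 * M⌋₊, ‖α m‖ ^ 2) *
          Real.sqrt (∑ n ∈ Icc 1 ⌊2 * N⌋₊, ‖β n‖ ^ 2) *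
          (K * (|(k : ℝ)| + |M * N|) ^ (3 / 8 : ℝ) * (|M| + |N|) ^ (11 / 48 + ε)) := by
  obtain ⟨L₀, hL₀⟩ := DFI_card_primes_Ioc_ge
  set δ : ℝ := ε / 8 with hδ
  have hδ0 : 0 < δ := by rw [hδ]; positivity
  obtain ⟨C_d, hC_d1, hC_d⟩ :=
    Literature.NumberTheory.Sieve.exists_card_divisors_le_mul_rpow' (half_pos hδ0)
  obtain ⟨Y₀, hY₀2, hY₀⟩ := kff_threshold ((L₀ : ℝ) + 5)
  set C_S : ℝ := 5000 * C_d + 6 + 3 / δ with hC_S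
  have hC_S6 : 6 ≤ C_S := by
    rw [hC_S]
    have : 0 ≤ 3 / δ := by positivity
    nlinarith
  set K : ℝ := max (1920 * C_S ^ 4) (Real.sqrt 6 * max Y₀ 1) with hK
  refine ⟨K, lt_max_of_lt_left (by positivity), ?_⟩
  intro M N hM hN k hk α β hα hβ hβcop
  have hM0 : 0 < M := by linarith
  have hN0 : 0 < N := by linarith
  have hy1 : 1 ≤ M + N := by linarith
  have hy0 : 0 < M + N := by linarith
  set nα := Real.sqrt (∑ m ∈ Icc 1 ⌊2 * M⌋₊, ‖α m‖ ^ 2) with hnα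
  set nβ := Real.sqrt (∑ n ∈ Icc 1 ⌊2 * N⌋₊, ‖β n‖ ^ 2) with hnβ
  have hnα0 : 0 ≤ nα := Real.sqrt_nonneg _
  have hnβ0 : 0 ≤ nβ := Real.sqrt_nonneg _
  rw [abs_of_pos (mul_pos hM0 hN0), abs_of_pos hM0, abs_of_pos hN0]
  set A : ℝ := |(k : ℝ)| + M * N with hA
  have hk1 : (1 : ℝ) ≤ |(k : ℝ)| := by
    rw [← Int.cast_abs]; exact_mod_cast Int.one_le_abs hk
  have hkabs : ((k.natAbs : ℕ) : ℝ) = |(k : ℝ)| := by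
    rw [← Int.cast_natCast, Int.natCast_natAbs, Int.cast_abs]
  have hA1 : 1 ≤ A := by rw [hA]; nlinarith
  have hβ' : ∀ n, β n ≠ 0 → N < n ∧ (n : ℝ) ≤ 2 * N ∧ n.Coprime k.natAbs :=
    fun n hn => ⟨(hβ n hn).1, (hβ n hn).2, hβcop n hn⟩
  -- exponent bookkeeping: `y^{11/48} · y^{ε} = y^{11/48+ε}`, `y^{11/48} ≤ y^{11/48+ε}`
  have hexp_add : (M + N) ^ (11 / 48 : ℝ) * (M + N) ^ ε = (M + N) ^ (11 / 48 + ε) :=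
    (Real.rpow_add hy0 _ _).symm
  have hexp_le : (M + N) ^ (11 / 48 : ℝ) ≤ (M + N) ^ (11 / 48 + ε) :=
    Real.rpow_le_rpow_of_exponent_le hy1 (by linarith)
  have hApow0 : 0 ≤ A ^ (3 / 8 : ℝ) := by positivity
  by_cases hmain : (1 ≤ M ∧ 1 ≤ N) ∧ (N ^ 5 ≤ M ^ 6 ∧ M ^ 5 ≤ N ^ 6) ∧
      ((k.natAbs : ℝ) ^ 3 ≤ (M * N) ^ 4) ∧ Y₀ ≤ M + N
  · -- the main regime
    obtain ⟨⟨hM1, hN1⟩, ⟨hw1, hw2⟩, hk3, hyY⟩ := hmain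
    set T' : ℝ := C_d * (5000 * (M + N) ^ 4) ^ (δ / 2) with hT'
    set S : ℝ := C_S * (M + N) ^ (2 * δ) with hS
    have hypow1 : 1 ≤ (M + N) ^ (2 * δ) := Real.one_le_rpow hy1 (by positivity)
    have hT'hyp : ∀ w : ℕ, 1 ≤ w → (w : ℝ) ≤ 5000 * (M + N) ^ 4 → (w.divisors.card : ℝ) ≤ T' := by
      intro w hw hw'
      refine (hC_d w).trans ?_
      rw [hT']
      exact mul_le_mul_of_nonneg_left (Real.rpow_le_rpow (Nat.cast_nonneg _) hw' (by positivity))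
        (by linarith)
    have hS1 : 1 ≤ S := by
      rw [hS]; nlinarith
    have hST : T' ≤ S := by
      rw [hT', hS]
      have h1 : (5000 * (M + N) ^ 4 : ℝ) ^ (δ / 2) = (5000 : ℝ) ^ (δ / 2) * (M + N) ^ (2 * δ) := by
        rw [Real.mul_rpow (by norm_num) (by positivity)]
        congr 1
        rw [← Real.rpow_natCast, ← Real.rpow_mul hy0.le]
        congr 1; push_cast; ring
      have h2 : (5000 : ℝ) ^ (δ / 2) ≤ 5000 := by
        have := Real.rpow_le_rpow_of_exponent_le (show (1:ℝ) ≤ 5000 by norm_num)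
          (show δ / 2 ≤ 1 by rw [hδ]; linarith)
        rwa [Real.rpow_one] at this
      rw [h1]
      have h3 : C_d * ((5000 : ℝ) ^ (δ / 2) * (M + N) ^ (2 * δ)) ≤ (5000 * C_d) * (M + N) ^ (2 * δ) := by
        rw [show (5000 * C_d) * (M + N) ^ (2 * δ) = C_d * (5000 * (M + N) ^ (2 * δ)) by ring]
        exact mul_le_mul_of_nonneg_left (mul_le_mul_of_nonneg_right h2 (by positivity)) (by linarith)
      refine h3.trans (mul_le_mul_of_nonneg_right ?_ (by positivity))
      rw [hC_S]
      have : 0 ≤ 3 / δ := by positivity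
      linarith
    have hSlog : 6 + 3 * Real.log (M + N) ≤ S := by
      rw [hS]
      have h1 : Real.log (M + N) ≤ (M + N) ^ δ / δ := Real.log_le_rpow_div hy0.le hδ0
      have h2 : (M + N) ^ δ ≤ (M + N) ^ (2 * δ) := Real.rpow_le_rpow_of_exponent_le hy1 (by linarith)
      have h3 : 3 * Real.log (M + N) ≤ 3 / δ * (M + N) ^ (2 * δ) := by
        calc 3 * Real.log (M + N) ≤ 3 * ((M + N) ^ δ / δ) := by linarith
          _ = 3 / δ * (M + N) ^ δ := by field_simp
          _ ≤ 3 / δ * (M + N) ^ (2 * δ) := mul_le_mul_of_nonneg_left h2 (by positivity)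
      have h4 : (6 : ℝ) ≤ 6 * (M + N) ^ (2 * δ) := by nlinarith
      have h5 : (6 + 3 / δ) * (M + N) ^ (2 * δ) ≤ C_S * (M + N) ^ (2 * δ) := by
        refine mul_le_mul_of_nonneg_right ?_ (by positivity)
        rw [hC_S]; nlinarith
      nlinarith
    -- `hbig`
    have hbig : (L₀ : ℝ) + 2 + 4 * (Real.log N / 2 + Real.log k.natAbs + Real.log ⌊2 * M⌋₊) ≤
        (M ^ 4 / N ^ 3) ^ (1 / 8 : ℝ) := by
      have hth := hY₀ (M + N) hyY
      have hlogy : 0 ≤ Real.log (M + N) := Real.log_nonneg hy1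
      have hx : 0 ≤ Real.log M := Real.log_nonneg hM1
      have hy' : 0 ≤ Real.log N := Real.log_nonneg hN1
      -- (i) the left side is at most `L₀ + 5 + 17 log (M+N)`
      have i1 : Real.log N ≤ Real.log (M + N) := Real.log_le_log hN0 (by linarith)
      have i2 : Real.log k.natAbs ≤ 8 / 3 * Real.log (M + N) := by
        have h1 : 3 * Real.log k.natAbs ≤ 4 * Real.log (M * N) := by
          have := Real.log_le_log (by positivity) hk3
          rw [Real.log_pow, Real.log_pow] at this
          exact_mod_cast this
        have h2 : Real.log (M * N) ≤ 2 * Real.log (M + N) := by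
          have h3 : M * N ≤ (M + N) ^ 2 := by nlinarith
          have := Real.log_le_log (by positivity) h3
          rw [Real.log_pow] at this; exact_mod_cast this
        linarith
      have i3 : Real.log ⌊2 * M⌋₊ ≤ Real.log 2 + Real.log (M + N) := by
        rw [← Real.log_mul (by norm_num) hy0.ne']
        refine Real.log_le_log ?_ ((Nat.floor_le (by linarith)).trans (by linarith))
        exact_mod_cast Nat.floor_pos.mpr (by linarith)
      have hlog2 : Real.log 2 < 0.6931471808 := Real.log_two_lt_d9
      have lhs_le : (L₀ : ℝ) + 2 + 4 * (Real.log N / 2 + Real.log k.natAbs + Real.log ⌊2 * M⌋₊) ≤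
          (L₀ : ℝ) + 5 + 17 * Real.log (M + N) := by nlinarith
      -- (ii) `(y/2)^{5/144} ≤ (M⁴/N³)^{1/8}`
      have rhs_ge : ((M + N) / 2) ^ (5 / 144 : ℝ) ≤ (M ^ 4 / N ^ 3) ^ (1 / 8 : ℝ) := by
        rw [← Real.log_le_log_iff (by positivity) (by positivity), Real.log_rpow (by positivity),
          Real.log_rpow (by positivity), Real.log_div hy0.ne' (by norm_num),
          Real.log_div (by positivity) (by positivity), Real.log_pow, Real.log_pow]
        have hw1' : 5 * Real.log N ≤ 6 * Real.log M := by
          have := Real.log_le_log (by positivity) hw1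
          rw [Real.log_pow, Real.log_pow] at this; exact_mod_cast this
        have hw2' : 5 * Real.log M ≤ 6 * Real.log N := by
          have := Real.log_le_log (by positivity) hw2
          rw [Real.log_pow, Real.log_pow] at this; exact_mod_cast this
        have hlog2' : 0 < Real.log 2 := Real.log_pos (by norm_num)
        rcases le_total M N with hMN | hMN
        · have : Real.log (M + N) ≤ Real.log 2 + Real.log N := by
            rw [← Real.log_mul (by norm_num) hN0.ne']
            exact Real.log_le_log hy0 (by linarith)
          push_cast
          nlinarith
        · have : Real.log (M + N) ≤ Real.log 2 + Real.log M := by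
            rw [← Real.log_mul (by norm_num) hM0.ne']
            exact Real.log_le_log hy0 (by linarith)
          push_cast
          nlinarith
      linarith
    have hB := kff_B_main k hk α β hM1 hN1 hw1 hw2 hα hβ' hL₀ hbig hT'hyp hS1 hST hSlog
    -- `S⁴ = C_S⁴ (M+N)^{ε}`
    have hS4 : S ^ 4 = C_S ^ 4 * (M + N) ^ ε := by
      rw [hS, mul_pow]
      congr 1
      rw [← Real.rpow_natCast, ← Real.rpow_mul hy0.le]
      congr 1; rw [hδ]; push_cast; ring
    have hKge : 1920 * C_S ^ 4 ≤ K := le_max_left _ _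
    calc _ ≤ 1920 * S ^ 4 * nα * nβ * (A ^ (3 / 8 : ℝ) * (M + N) ^ (11 / 48 : ℝ)) := hB
      _ = nα * nβ * ((1920 * C_S ^ 4) * A ^ (3 / 8 : ℝ) * ((M + N) ^ (11 / 48 : ℝ) * (M + N) ^ ε)) := by
          rw [hS4]; ring
      _ = nα * nβ * ((1920 * C_S ^ 4) * A ^ (3 / 8 : ℝ) * (M + N) ^ (11 / 48 + ε)) := by
          rw [hexp_add]
      _ ≤ nα * nβ * (K * A ^ (3 / 8 : ℝ) * (M + N) ^ (11 / 48 + ε)) := by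
          refine mul_le_mul_of_nonneg_left ?_ (by positivity)
          exact mul_le_mul_of_nonneg_right (mul_le_mul_of_nonneg_right hKge hApow0) (by positivity)
  · -- the trivial regime
    have htriv : (M * N) ^ 6 ≤ (M + N) ^ 11 ∨ (M * N) ^ 4 ≤ (k.natAbs : ℝ) ^ 3 ∨ M + N ≤ Y₀ := by
      by_cases h4 : Y₀ ≤ M + N
      swap
      · exact Or.inr (Or.inr (le_of_lt (not_le.mp h4)))
      by_cases h3 : (k.natAbs : ℝ) ^ 3 ≤ (M * N) ^ 4
      swap
      · exact Or.inr (Or.inl (le_of_lt (not_le.mp h3)))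
      left
      have hMN0 : 0 ≤ M * N := by positivity
      have hy11 : (M + N) ^ 6 ≤ (M + N) ^ 11 := pow_le_pow_right₀ hy1 (by norm_num)
      by_cases h1 : 1 ≤ M ∧ 1 ≤ N
      · -- out of the window
        have hw : ¬ (N ^ 5 ≤ M ^ 6 ∧ M ^ 5 ≤ N ^ 6) := fun hw => hmain ⟨h1, hw, h3, h4⟩
        rcases not_and_or.mp hw with hw | hw
        · have hw' : M ^ 6 < N ^ 5 := not_le.mp hw
          have hN1 : 1 ≤ N := h1.2
          calc (M * N) ^ 6 = M ^ 6 * N ^ 6 := mul_pow _ _ _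
            _ ≤ N ^ 5 * N ^ 6 := mul_le_mul_of_nonneg_right hw'.le (by positivity)
            _ = N ^ 11 := by ring
            _ ≤ (M + N) ^ 11 := pow_le_pow_left₀ hN0.le (by linarith) 11
        · have hw' : N ^ 6 < M ^ 5 := not_le.mp hw
          calc (M * N) ^ 6 = N ^ 6 * M ^ 6 := by rw [mul_pow, mul_comm]
            _ ≤ M ^ 5 * M ^ 6 := mul_le_mul_of_nonneg_right hw'.le (by positivity)
            _ = M ^ 11 := by ring
            _ ≤ (M + N) ^ 11 := pow_le_pow_left₀ hM0.le (by linarith) 11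
      · -- `min(M,N) < 1`
        rcases not_and_or.mp h1 with h1 | h1
        · have hM1 : M < 1 := not_le.mp h1
          have : M * N ≤ M + N := by nlinarith
          exact (pow_le_pow_left₀ hMN0 this 6).trans hy11
        · have hN1 : N < 1 := not_le.mp h1
          have : M * N ≤ M + N := by nlinarith
          exact (pow_le_pow_left₀ hMN0 this 6).trans hy11
    have hB := kfB_triv M N hM hN0.le k α β hα
    have ht := kff_triv_regime (Y₀ := Y₀) hM hN hk htriv
    have hKge : Real.sqrt 6 * max Y₀ 1 ≤ K := le_max_right _ _
    calc _ ≤ Real.sqrt (6 * M * N) * nα * nβ := hB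
      _ ≤ (Real.sqrt 6 * max Y₀ 1 * (A ^ (3 / 8 : ℝ) * (M + N) ^ (11 / 48 : ℝ))) * nα * nβ :=
          mul_le_mul_of_nonneg_right (mul_le_mul_of_nonneg_right ht hnα0) hnβ0
      _ = nα * nβ * ((Real.sqrt 6 * max Y₀ 1) * A ^ (3 / 8 : ℝ) * (M + N) ^ (11 / 48 : ℝ)) := by ring
      _ ≤ nα * nβ * (K * A ^ (3 / 8 : ℝ) * (M + N) ^ (11 / 48 + ε)) := by
          refine mul_le_mul_of_nonneg_left ?_ (by positivity)
          exact mul_le_mul (mul_le_mul_of_nonneg_right hKge hApow0) hexp_le (by positivity)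
            (by positivity)

/-! ### Theorem 2 -/

set_option maxHeartbeats 2000000 in
/-- **Duke–Friedlander–Iwaniec, Theorem 2** (bilinear forms with Kloosterman fractions,
`X = 0`): for every `ε > 0` there is `K` such that for `M, N ≥ 1/2`, `k ≠ 0`, `α` supported on
`M < m ≤ 2M` and `β` on `N < n ≤ 2N`,
`‖Σ_{(m,n)=1} α_m β_n e(k m̄/n)‖ ≤ K ‖α‖ ‖β‖ (|k| + MN)^{3/8} (M+N)^{11/48+ε}`.
Reduction to `β` supported on integers coprime to `k` by `DFI_bilinear_bound_of_coprime_case`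
(`τ(|k|)^{1/2} ≪ (M+N)^{ε/2}` for `|k|³ ≤ (MN)⁴`, the trivial bound otherwise), then `kff_core`.
[cite: DukeFriedlanderIwaniec1997, Theorem 2] -/
theorem kff_h0 : ∀ ε : ℝ, 0 < ε → ∃ K : ℝ, 0 < K ∧
    ∀ (M N : ℝ), 1 / 2 ≤ M → 1 / 2 ≤ N → ∀ (k : ℤ), k ≠ 0 → ∀ (α β : ℕ → ℂ),
      (∀ m : ℕ, α m ≠ 0 → M < m ∧ (m : ℝ) ≤ 2 * M) →
      (∀ n : ℕ, β n ≠ 0 → N < n ∧ (n : ℝ) ≤ 2 * N) →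
      ‖∑ m ∈ Icc 1 ⌊2 * M⌋₊, ∑ n ∈ Icc 1 ⌊2 * N⌋₊,
          if m.Coprime n then
            α m * β n * Complex.exp (2 * Real.pi * Complex.I *
              ((k : ℂ) * ((((m : ZMod n)⁻¹).val : ℕ) : ℂ) / (n : ℂ)))
          else 0‖ ≤
        K * Real.sqrt (∑ m ∈ Icc 1 ⌊2 * M⌋₊, ‖α m‖ ^ 2) *
          Real.sqrt (∑ n ∈ Icc 1 ⌊2 * N⌋₊, ‖β n‖ ^ 2) *
          (|(k : ℝ)| + M * N) ^ (3 / 8 : ℝ) * (M + N) ^ (11 / 48 + ε) := by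
  intro ε hε
  set ε₁ : ℝ := min ε 1 with hε₁
  have hε₁0 : 0 < ε₁ := lt_min hε one_pos
  have hε₁1 : ε₁ ≤ 1 := min_le_right _ _
  have hε₁ε : ε₁ ≤ ε := min_le_left _ _
  obtain ⟨K₁, hK₁, hcore⟩ := kff_core (ε := ε₁ / 2) (by positivity) (by linarith)
  set e : ℝ := 3 * ε₁ / 8 with he
  have he0 : 0 < e := by rw [he]; positivity
  obtain ⟨C_τ, hC_τ1, hC_τ⟩ := Literature.NumberTheory.Sieve.exists_card_divisors_le_mul_rpow' he0
  set G : ℝ → ℝ → ℤ → ℝ := fun M N k =>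
    K₁ * (|(k : ℝ)| + |M * N|) ^ (3 / 8 : ℝ) * (|M| + |N|) ^ (11 / 48 + ε₁ / 2) with hG
  have hG0 : ∀ M N k, 0 ≤ G M N k := fun M N k => by simp only [hG]; positivity
  have hGmono : ∀ (M N : ℝ) (k : ℤ) (d : ℕ), 0 < d → (d : ℤ) ∣ k → G M (N / d) (k / d) ≤ G M N k := by
    intro M N k d hd _
    simp only [hG]
    have hd1 : (1 : ℝ) ≤ d := by exact_mod_cast hd
    have hd0 : (0 : ℝ) < d := by linarith
    have h1 : |((k / d : ℤ) : ℝ)| ≤ |(k : ℝ)| := by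
      have e1 : ∀ z : ℤ, |(z : ℝ)| = ((z.natAbs : ℕ) : ℝ) := fun z => by
        rw [← Int.cast_natCast, Int.natCast_natAbs, Int.cast_abs]
      rw [e1, e1]
      exact_mod_cast Int.natAbs_ediv_le_natAbs k d
    have h2 : |M * (N / d)| ≤ |M * N| := by
      rw [show M * (N / d) = M * N / d by ring, abs_div, abs_of_pos hd0]
      exact div_le_self (abs_nonneg _) hd1
    have h3 : |N / (d : ℝ)| ≤ |N| := by
      rw [abs_div, abs_of_pos hd0]; exact div_le_self (abs_nonneg _) hd1
    have h4 : (|((k / d : ℤ) : ℝ)| + |M * (N / d)|) ^ (3 / 8 : ℝ) ≤ (|(k : ℝ)| + |M * N|) ^ (3 / 8 : ℝ) :=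
      Real.rpow_le_rpow (by positivity) (by linarith) (by norm_num)
    have h5 : (|M| + |N / (d : ℝ)|) ^ (11 / 48 + ε₁ / 2) ≤ (|M| + |N|) ^ (11 / 48 + ε₁ / 2) :=
      Real.rpow_le_rpow (by positivity) (by linarith) (by positivity)
    exact mul_le_mul (mul_le_mul_of_nonneg_left h4 hK₁.le) h5 (by positivity) (by positivity)
  set K : ℝ := max (Real.sqrt C_τ * K₁) (Real.sqrt 6) with hK
  refine ⟨K, lt_max_of_lt_right (Real.sqrt_pos.mpr (by norm_num)), ?_⟩
  intro M N hM hN k hk α β hα hβ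
  have hM0 : 0 < M := by linarith
  have hN0 : 0 < N := by linarith
  have hy1 : 1 ≤ M + N := by linarith
  have hy0 : 0 < M + N := by linarith
  set nα := Real.sqrt (∑ m ∈ Icc 1 ⌊2 * M⌋₊, ‖α m‖ ^ 2) with hnα
  set nβ := Real.sqrt (∑ n ∈ Icc 1 ⌊2 * N⌋₊, ‖β n‖ ^ 2) with hnβ
  have hnα0 : 0 ≤ nα := Real.sqrt_nonneg _
  have hnβ0 : 0 ≤ nβ := Real.sqrt_nonneg _
  set A : ℝ := |(k : ℝ)| + M * N with hA
  have hkabs : ((k.natAbs : ℕ) : ℝ) = |(k : ℝ)| := by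
    rw [← Int.cast_natCast, Int.natCast_natAbs, Int.cast_abs]
  have hApow0 : 0 ≤ A ^ (3 / 8 : ℝ) := by positivity
  have hexp_le : (M + N) ^ (11 / 48 + ε₁) ≤ (M + N) ^ (11 / 48 + ε) :=
    Real.rpow_le_rpow_of_exponent_le hy1 (by linarith)
  have hexp_le' : (M + N) ^ (11 / 48 : ℝ) ≤ (M + N) ^ (11 / 48 + ε) :=
    Real.rpow_le_rpow_of_exponent_le hy1 (by linarith)
  by_cases hk3 : (k.natAbs : ℝ) ^ 3 ≤ (M * N) ^ 4
  · have h := DFI_bilinear_bound_of_coprime_case G hG0 hGmono hcore M N hM hN k hk α β hα hβ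
    -- `√τ(|k|) ≤ √C_τ (M+N)^{ε₁/2}`
    have hτ : (k.natAbs.divisors.card : ℝ) ≤ C_τ * (M + N) ^ ε₁ := by
      refine (hC_τ k.natAbs).trans (mul_le_mul_of_nonneg_left ?_ (by linarith))
      have h1 : ((k.natAbs : ℕ) : ℝ) ^ e = (((k.natAbs : ℕ) : ℝ) ^ 3) ^ (e / 3) := by
        rw [← Real.rpow_natCast, ← Real.rpow_mul (Nat.cast_nonneg _)]
        congr 1; push_cast; ring
      have h2 : (((k.natAbs : ℕ) : ℝ) ^ 3) ^ (e / 3) ≤ ((M * N) ^ 4) ^ (e / 3) :=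
        Real.rpow_le_rpow (by positivity) hk3 (by positivity)
      have h3 : ((M * N) ^ 4) ^ (e / 3) ≤ (((M + N) ^ 2) ^ 4) ^ (e / 3) := by
        refine Real.rpow_le_rpow (by positivity) ?_ (by positivity)
        exact pow_le_pow_left₀ (by positivity) (by nlinarith) 4
      have h4 : (((M + N) ^ 2) ^ 4) ^ (e / 3) = (M + N) ^ ε₁ := by
        rw [← pow_mul, ← Real.rpow_natCast, ← Real.rpow_mul hy0.le]
        congr 1; rw [he]; push_cast; ring
      rw [h1]
      linarith [h2, h3, h4.le, h4.ge]
    have hsqrtτ : Real.sqrt (k.natAbs.divisors.card : ℝ) ≤ Real.sqrt C_τ * (M + N) ^ (ε₁ / 2) := by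
      calc Real.sqrt (k.natAbs.divisors.card : ℝ) ≤ Real.sqrt (C_τ * (M + N) ^ ε₁) :=
            Real.sqrt_le_sqrt hτ
        _ = Real.sqrt C_τ * (M + N) ^ (ε₁ / 2) := by
            rw [Real.sqrt_mul (by linarith), Real.sqrt_eq_rpow ((M + N) ^ ε₁),
              ← Real.rpow_mul hy0.le]
            congr 2; ring
    have hGval : G M N k = K₁ * A ^ (3 / 8 : ℝ) * (M + N) ^ (11 / 48 + ε₁ / 2) := by
      simp only [hG]
      rw [abs_of_pos (mul_pos hM0 hN0), abs_of_pos hM0, abs_of_pos hN0]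
    have hexp_add : (M + N) ^ (ε₁ / 2) * (M + N) ^ (11 / 48 + ε₁ / 2) = (M + N) ^ (11 / 48 + ε₁) := by
      rw [← Real.rpow_add hy0]; congr 1; ring
    have hKge : Real.sqrt C_τ * K₁ ≤ K := le_max_left _ _
    calc _ ≤ Real.sqrt (k.natAbs.divisors.card : ℝ) * nα * nβ * G M N k := h
      _ ≤ (Real.sqrt C_τ * (M + N) ^ (ε₁ / 2)) * nα * nβ * G M N k :=
          mul_le_mul_of_nonneg_right (mul_le_mul_of_nonneg_right
            (mul_le_mul_of_nonneg_right hsqrtτ hnα0) hnβ0) (hG0 M N k)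
      _ = (Real.sqrt C_τ * K₁) * nα * nβ * A ^ (3 / 8 : ℝ) *
            ((M + N) ^ (ε₁ / 2) * (M + N) ^ (11 / 48 + ε₁ / 2)) := by rw [hGval]; ring
      _ = (Real.sqrt C_τ * K₁) * nα * nβ * A ^ (3 / 8 : ℝ) * (M + N) ^ (11 / 48 + ε₁) := by
          rw [hexp_add]
      _ ≤ K * nα * nβ * A ^ (3 / 8 : ℝ) * (M + N) ^ (11 / 48 + ε) :=
          mul_le_mul (mul_le_mul_of_nonneg_right (mul_le_mul_of_nonneg_right
            (mul_le_mul_of_nonneg_right hKge hnα0) hnβ0) hApow0) hexp_le (by positivity)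
            (by positivity)
  · -- `|k|³ > (MN)⁴`: the trivial bound
    have hk3' : (M * N) ^ 4 ≤ (k.natAbs : ℝ) ^ 3 := (not_le.mp hk3).le
    have hB := kfB_triv M N hM hN0.le k α β hα
    have ht := kff_triv_regime (Y₀ := 1) hM hN hk (Or.inr (Or.inl hk3'))
    rw [max_self, mul_one] at ht
    have hKge : Real.sqrt 6 ≤ K := le_max_right _ _
    calc _ ≤ Real.sqrt (6 * M * N) * nα * nβ := hB
      _ ≤ (Real.sqrt 6 * (A ^ (3 / 8 : ℝ) * (M + N) ^ (11 / 48 : ℝ))) * nα * nβ :=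
          mul_le_mul_of_nonneg_right (mul_le_mul_of_nonneg_right ht hnα0) hnβ0
      _ = Real.sqrt 6 * nα * nβ * A ^ (3 / 8 : ℝ) * (M + N) ^ (11 / 48 : ℝ) := by ring
      _ ≤ K * nα * nβ * A ^ (3 / 8 : ℝ) * (M + N) ^ (11 / 48 + ε) :=
          mul_le_mul (mul_le_mul_of_nonneg_right (mul_le_mul_of_nonneg_right
            (mul_le_mul_of_nonneg_right hKge hnα0) hnβ0) hApow0) hexp_le' (by positivity)
            (by positivity)

end Literature.NumberTheory.LFunctions

end
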